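import Mathlib.Algebra.Polynomial.Roots
import Mathlib.Algebra.MvPolynomial.Funext
import Literature.NumberTheory.Automorphic.ZariskiAffineSpace
import HarnessLib

/-!
# A curve criterion on `k`-points: finite fibres and infinite closed subsets
(trunk T-AUTOMORPHIC, G25 AutomorphicL; input of the rank-one analysis `G/B ≅ ℙ¹` (Springer 7.1.5,
7.2.2) behind the Bruhat decomposition `bruhat_rankOne_of_central` of lang.S13 (b))

Companion to `ZariskiAffineSpace.lean` (the Zariski topology `zariskiTopologyPi` on `σ → k`, closed
sets = zero loci, Chevalley's theorem on images `exists_isOpen_inter_closure_image_subset`). An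
elementary replacement, on `k`-points over an algebraically closed field, for the dimension
statement "an irreducible variety carrying a function with finite fibres is a curve, and a proper
closed subset of an irreducible curve is finite" (Springer, *Linear Algebraic Groups*, 1.8.1–1.8.2,
5.2.7). All proved:

* `isPrime_vanishingIdeal_pi_of_isIrreducible` (Springer 1.2.5 for `kⁿ`): an irreducible subset
  has a prime vanishing ideal;
* `exists_infinite_slice_of_isOpen`: a non-empty open subset of the plane has an infinite vertical
  slice; `exists_expansion`: `p(x, y) = ∑ⱼ Gⱼ(x) yʲ`;
* `exists_relation_of_finite_fibres`: for `A ⊆ kⁿ` closed irreducible and a polynomial function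
  `π` with finite fibres on `A`, every polynomial function `h` is algebraically dependent on `π`
  along `A`: `∑ⱼ Gⱼ(π) hʲ = 0` on `A` with one-variable `Gⱼ` not all zero (otherwise `(π, h)(A)` is
  dense in the plane and, by Chevalley's theorem, contains a non-empty open set, whose infinite
  vertical slice is an infinite fibre of `π`);
* **`eq_of_isClosed_of_infinite_image` (curve criterion)**: under the same hypotheses, a closed
  `Z ⊆ A` on which `π` takes infinitely many values equals `A` (the relation for a polynomial `h`
  vanishing on `Z`, divided by the exact power of `h`, would give a non-zero one-variable
  polynomial vanishing on `π(Z)`; primality of `𝓘(A)`).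

Used in the proof of the Bruhat decomposition in semisimple rank one: the orbit `G · x₀ ⊂ ℙ(V)` of
the highest weight line minus `x₀` is an affine set on which the lowest-weight coordinate has
finite fibres (finiteness lemma of `ZariskiCones.lean`) and which contains the curve `U n x₀`.

## Mathlib

`MvPolynomial.vanishingIdeal`, `MvPolynomial.funext`, `MvPolynomial.eval_eq'`,
`MvPolynomial.degreeOf`, `Polynomial.eq_zero_of_infinite_isRoot`, `Polynomial.aeval_algHom_apply`,
`Nat.find`. No Mathlib counterpart (Mathlib's dimension theory lives on `PrimeSpectrum`; there is
no Zariski topology on naive points).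

## References

* [SpringerLAG1998] T. A. Springer, *Linear Algebraic Groups*, 2nd ed., Progress in Mathematics 9,
  Birkhäuser (1998): 1.2.5, 1.8.1–1.8.2, 1.9.5.
-/

open MvPolynomial

namespace Literature.NumberTheory.Automorphic

variable {k : Type*} [Field k] {σ : Type*}

attribute [local instance] zariskiTopologyPi

/-! ### Irreducible closed sets have prime ideals -/

/-- Membership in the vanishing ideal of a set of `k`-points: `p ∈ 𝓘(V) ↔ p` vanishes on `V`. [folklore] -/
theorem mem_vanishingIdeal_pi_iff {V : Set (σ → k)} {p : MvPolynomial σ k} :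
    p ∈ MvPolynomial.vanishingIdeal k V ↔ ∀ x ∈ V, MvPolynomial.eval x p = 0 := by
  simp [MvPolynomial.mem_vanishingIdeal_iff]

/-- **An irreducible subset of `kⁿ` has a prime vanishing ideal** (Springer 1.2.5: a closed `X` is
irreducible iff `𝓘(X)` is prime; here the useful direction, for any irreducible subset). [cite: SpringerLAG1998, 1.2.5] -/
theorem isPrime_vanishingIdeal_pi_of_isIrreducible {A : Set (σ → k)} (hA : IsIrreducible A) :
    (MvPolynomial.vanishingIdeal k A).IsPrime := by
  rw [Ideal.isPrime_iff]
  refine ⟨fun htop => ?_, fun {f g} hfg => ?_⟩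
  · obtain ⟨x, hx⟩ := hA.nonempty
    have h1 : (1 : MvPolynomial σ k) ∈ MvPolynomial.vanishingIdeal k A := htop ▸ Submodule.mem_top
    have := mem_vanishingIdeal_pi_iff.1 h1 x hx
    simp at this
  · have hsub : A ⊆ {x | MvPolynomial.eval x f = 0} ∪ {x | MvPolynomial.eval x g = 0} := by
      intro x hx
      have h0 := mem_vanishingIdeal_pi_iff.1 hfg x hx
      rw [map_mul, mul_eq_zero] at h0
      exact h0
    rcases isPreirreducible_iff_isClosed_union_isClosed.1 hA.2 _ _ (isClosed_setOf_eval_eq_zero f)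
      (isClosed_setOf_eval_eq_zero g) hsub with h | h
    · exact Or.inl (mem_vanishingIdeal_pi_iff.2 fun x hx => h hx)
    · exact Or.inr (mem_vanishingIdeal_pi_iff.2 fun x hx => h hx)

/-! ### Vertical slices of open subsets of the plane -/

section Plane

variable {R : Type*}

/-- A point of the plane `R²` from its two coordinates. [folklore] -/
def pt2 (x y : R) : Fin 2 → R := ![x, y]

/-- First coordinate of `pt2`. [folklore] -/
@[simp] lemma pt2_zero (x y : R) : pt2 x y 0 = x := rfl

/-- Second coordinate of `pt2`. [folklore] -/
@[simp] lemma pt2_one (x y : R) : pt2 x y 1 = y := rfl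

/-- Every point of the plane is a `pt2`. [folklore] -/
lemma pt2_eta (z : Fin 2 → R) : pt2 (z 0) (z 1) = z := by
  ext i; fin_cases i <;> rfl

end Plane

/-- Restricting a polynomial on the plane to the vertical line `x = c` gives a one-variable
polynomial `q` with `q(y) = p(c, y)`. [folklore] -/
theorem exists_polynomial_slice (p : MvPolynomial (Fin 2) k) (c : k) :
    ∃ q : Polynomial k, ∀ y : k, q.eval y = MvPolynomial.eval (pt2 c y) p := by
  refine ⟨MvPolynomial.aeval (![Polynomial.C c, Polynomial.X] : Fin 2 → Polynomial k) p,
    fun y => ?_⟩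
  rw [← Polynomial.coe_aeval_eq_eval, ← AlgHom.comp_apply, MvPolynomial.comp_aeval,
    MvPolynomial.aeval_eq_eval]
  refine congrArg (fun f => MvPolynomial.eval f p) ?_
  funext i; fin_cases i <;> simp [pt2]

/-- **A non-empty open subset of the plane has an infinite vertical slice**: there is `c` with
`{y | (c, y) ∈ W}` infinite (a point of `W` off a hypersurface `p = 0`; on its vertical line `p`
restricts to a non-zero polynomial with finitely many roots). [folklore] -/
theorem exists_infinite_slice_of_isOpen [Infinite k] {W : Set (Fin 2 → k)} (hW : IsOpen W)
    (hne : W.Nonempty) : ∃ c : k, {y : k | pt2 c y ∈ W}.Infinite := by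
  classical
  obtain ⟨S, hS⟩ := isClosed_iff_exists_setOf_eval.1 hW.isClosed_compl
  obtain ⟨z, hz⟩ := hne
  have hz' : z ∉ Wᶜ := fun h => h hz
  rw [hS] at hz'
  simp only [Set.mem_setOf_eq, not_forall] at hz'
  obtain ⟨p, hpS, hpz⟩ := hz'
  refine ⟨z 0, ?_⟩
  obtain ⟨q, hq⟩ := exists_polynomial_slice p (z 0)
  have hq0 : q ≠ 0 := by
    intro h0
    apply hpz
    rw [← pt2_eta z, ← hq, h0, Polynomial.eval_zero]
  have hsub : {y : k | q.eval y ≠ 0} ⊆ {y : k | pt2 (z 0) y ∈ W} := by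
    intro y hy
    by_contra hyW
    have hmem : pt2 (z 0) y ∈ Wᶜ := hyW
    rw [hS] at hmem
    exact hy ((hq y).trans (hmem p hpS))
  refine Set.Infinite.mono hsub ?_
  have hfin : {y : k | q.eval y = 0}.Finite := by
    simpa using (q.roots.toFinset.finite_toSet).subset fun y hy => by
      simpa [Polynomial.mem_roots hq0] using hy
  have : {y : k | q.eval y ≠ 0} = {y : k | q.eval y = 0}ᶜ := by ext; simp
  rw [this]
  exact hfin.infinite_compl


/-! ### Finite fibres force an algebraic relation (the curve criterion, part 1) -/

section Relation

variable [Finite σ] [IsAlgClosed k]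

/-- Converting a polynomial on the plane into a `Y`-expansion `∑ⱼ Gⱼ(x) yʲ` with one-variable
coefficients `Gⱼ`. [folklore] -/
theorem exists_expansion (p : MvPolynomial (Fin 2) k) :
    ∃ (d : ℕ) (G : ℕ → Polynomial k), (p ≠ 0 → ∃ j ≤ d, G j ≠ 0) ∧
      ∀ x y : k, MvPolynomial.eval (pt2 x y) p =
        ∑ j ∈ Finset.range (d + 1), (G j).eval x * y ^ j := by
  classical
  -- `G j = ∑_{m : m 1 = j} coeff m p · X^{m 0}`
  set d := p.degreeOf 1 with hd
  set G : ℕ → Polynomial k := fun j => ∑ m ∈ p.support with m 1 = j,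
    Polynomial.monomial (m 0) (p.coeff m) with hG
  have hexp : ∀ x y : k, MvPolynomial.eval (pt2 x y) p =
      ∑ j ∈ Finset.range (d + 1), (G j).eval x * y ^ j := by
    intro x y
    rw [MvPolynomial.eval_eq']
    simp only [Fin.prod_univ_two, pt2_zero, pt2_one]
    -- regroup the sum over the support according to the exponent of `y`
    rw [← Finset.sum_fiberwise_of_maps_to (g := fun m : Fin 2 →₀ ℕ => m 1)
      (t := Finset.range (d + 1))]
    · refine Finset.sum_congr rfl fun j _ => ?_
      rw [hG, Polynomial.eval_finsetSum, Finset.sum_mul]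
      refine Finset.sum_congr rfl fun m hm => ?_
      rw [Polynomial.eval_monomial, ← (Finset.mem_filter.1 hm).2, mul_assoc]
    · intro m hm
      exact Finset.mem_range.2 (Nat.lt_succ_of_le (MvPolynomial.monomial_le_degreeOf 1 hm))
  refine ⟨d, G, fun hp => ?_, hexp⟩
  by_contra hall
  push Not at hall
  apply hp
  apply MvPolynomial.funext
  intro z
  rw [map_zero, ← pt2_eta z, hexp]
  refine Finset.sum_eq_zero fun j hj => ?_
  rw [hall j (Nat.lt_succ_iff.1 (Finset.mem_range.1 hj)), Polynomial.eval_zero, zero_mul]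

/-- **Finite fibres force a relation** (the first half of "`dim A ≤ 1`"): let `A ⊆ kⁿ` be closed and
irreducible over an algebraically closed field, `π` a polynomial function on `A` all of whose
fibres `A ∩ {π = c}` are finite, and `h` any polynomial function. Then `π|_A` and `h|_A` are
algebraically dependent: `∑ⱼ Gⱼ(π) hʲ = 0` on `A` for one-variable polynomials `Gⱼ`, not all zero.
Otherwise the image of `A` under `(π, h)` would be dense in the plane, hence (Chevalley's theorem,
`exists_isOpen_inter_closure_image_subset`) would contain a non-empty open subset, which has an
infinite vertical slice (`exists_infinite_slice_of_isOpen`) — an infinite fibre of `π`.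
(An elementary `k`-points substitute for "`dim A ≤ 1`"; Springer 1.8, 1.9.5.) [folklore] -/
theorem exists_relation_of_finite_fibres {A : Set (σ → k)} (hAcl : IsClosed A)
    (hAirr : IsIrreducible A) (π h : MvPolynomial σ k)
    (hfin : ∀ c : k, {a ∈ A | MvPolynomial.eval a π = c}.Finite) :
    ∃ (d : ℕ) (G : ℕ → Polynomial k), (∃ j ≤ d, G j ≠ 0) ∧
      ∀ a ∈ A, ∑ j ∈ Finset.range (d + 1),
        (G j).eval (MvPolynomial.eval a π) * (MvPolynomial.eval a h) ^ j = 0 := by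
  classical
  -- the map `Φ = (π, h) : kⁿ → k²`
  set P : Fin 2 → MvPolynomial σ k := ![π, h] with hP
  set Φ : (σ → k) → (Fin 2 → k) := fun a => pt2 (MvPolynomial.eval a π) (MvPolynomial.eval a h)
    with hΦ
  have hΦP : ∀ x t, Φ x t = MvPolynomial.eval x (P t) := by
    intro x t; fin_cases t <;> rfl
  -- some non-zero polynomial vanishes on `Φ(A)`
  have key : ∃ p : MvPolynomial (Fin 2) k, p ≠ 0 ∧ ∀ a ∈ A, MvPolynomial.eval (Φ a) p = 0 := by
    by_contra hcon
    push Not at hcon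
    -- then `Φ(A)` is dense
    have hdense : closure (Φ '' A) = Set.univ := by
      obtain ⟨S, hS⟩ := isClosed_iff_exists_setOf_eval.1 (isClosed_closure (s := Φ '' A))
      rw [hS, Set.eq_univ_iff_forall]
      intro z p hpS
      by_cases hp0 : p = 0
      · rw [hp0, map_zero]
      · exfalso
        obtain ⟨a, haA, hpa⟩ := hcon p hp0
        have hmem : Φ a ∈ closure (Φ '' A) := subset_closure ⟨a, haA, rfl⟩
        rw [hS] at hmem
        exact hpa (hmem p hpS)
    obtain ⟨W, hWopen, hWne, hWsub⟩ := exists_isOpen_inter_closure_image_subset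
      hAcl.isLocallyClosed hAirr.nonempty P hΦP
    rw [hdense, Set.inter_univ] at hWne hWsub
    obtain ⟨c, hc⟩ := exists_infinite_slice_of_isOpen hWopen hWne
    -- the fibre of `π` over `c` is infinite
    apply hc
    refine Set.Finite.subset ((hfin c).image fun a => MvPolynomial.eval a h) fun y hy => ?_
    obtain ⟨a, haA, hay⟩ := hWsub hy
    refine ⟨a, ⟨haA, ?_⟩, ?_⟩
    · have := congrFun hay 0; simpa [hΦ] using this
    · have := congrFun hay 1; simpa [hΦ] using this
  obtain ⟨p, hp0, hpA⟩ := key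
  obtain ⟨d, G, hG, hexp⟩ := exists_expansion p
  refine ⟨d, G, hG hp0, fun a ha => ?_⟩
  rw [← hexp]
  exact hpA a ha


omit [Finite σ] [IsAlgClosed k] in
/-- Substituting a polynomial `π` in the coordinates for the variable of `G ∈ k[X]` and evaluating
at a point is evaluating `G` at `π(a)`. [folklore] -/
lemma eval_polynomialAeval_pi (a : σ → k) (π : MvPolynomial σ k) (G : Polynomial k) :
    MvPolynomial.eval a (Polynomial.aeval π G) = G.eval (MvPolynomial.eval a π) := by
  have h := (Polynomial.aeval_algHom_apply (MvPolynomial.aeval a) π G).symm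
  rw [Polynomial.coe_aeval_eq_eval] at h
  rw [← MvPolynomial.coe_aeval_eq_eval]
  exact h

/-- **The curve criterion** ("`dim A ≤ 1`" on `k`-points, without dimension theory): let `A ⊆ kⁿ` be
closed and irreducible over an algebraically closed field and `π` a polynomial function with finite
fibres on `A`. Then every closed `Z ⊆ A` on which `π` takes infinitely many values is all of `A`.
Proof: for a polynomial `h` vanishing on `Z`, `exists_relation_of_finite_fibres` gives
`∑ⱼ Gⱼ(π) hʲ = 0` on `A`; if `j₀` is the least index with `G_{j₀} ≠ 0` then
`h^{j₀} · (G_{j₀}(π) + h · (…)) ∈ 𝓘(A)`, a prime ideal, and the second factor does not vanish on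
`Z` (where `h = 0` and `G_{j₀}(π)` has finitely many zeros); so `h ∈ 𝓘(A)`, i.e. `A ⊆ Z`. This is
the `k`-points form of the curve case of Springer 1.8.2 (a proper irreducible closed subvariety of
an irreducible variety has smaller dimension, so a proper closed subset of an irreducible curve is
finite), proved without dimension theory. [folklore] -/
theorem eq_of_isClosed_of_infinite_image {A Z : Set (σ → k)} (hAcl : IsClosed A)
    (hAirr : IsIrreducible A) (π : MvPolynomial σ k)
    (hfin : ∀ c : k, {a ∈ A | MvPolynomial.eval a π = c}.Finite) (hZcl : IsClosed Z) (hZA : Z ⊆ A)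
    (hZinf : ((fun z => MvPolynomial.eval z π) '' Z).Infinite) : Z = A := by
  classical
  refine Set.Subset.antisymm hZA fun a haA => ?_
  obtain ⟨S, hS⟩ := isClosed_iff_exists_setOf_eval.1 hZcl
  haveI hprime := isPrime_vanishingIdeal_pi_of_isIrreducible hAirr
  -- every polynomial vanishing on `Z` vanishes on `A`
  suffices key : ∀ h : MvPolynomial σ k, (∀ z ∈ Z, MvPolynomial.eval z h = 0) →
      h ∈ MvPolynomial.vanishingIdeal k A by
    rw [hS]
    intro q hqS
    have hq : q ∈ MvPolynomial.vanishingIdeal k A :=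
      key q fun z hz => by rw [hS] at hz; exact hz q hqS
    exact mem_vanishingIdeal_pi_iff.1 hq a haA
  intro h hZh
  obtain ⟨d, G, ⟨j₁, hj₁d, hj₁⟩, hrel⟩ := exists_relation_of_finite_fibres hAcl hAirr π h hfin
  have hex : ∃ j, G j ≠ 0 := ⟨j₁, hj₁⟩
  set j₀ := Nat.find hex with hj₀
  have hj₀spec : G j₀ ≠ 0 := Nat.find_spec hex
  have hj₀min : ∀ j < j₀, G j = 0 := fun j hj => by
    have := Nat.find_min hex (m := j) hj
    simpa using this
  have hj₀le : j₀ ≤ j₁ := Nat.find_min' hex hj₁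
  -- `Q = ∑_{j ≥ j₀} G_j(π) h^{j - j₀}`
  set Q : MvPolynomial σ k := ∑ j ∈ Finset.range (d + 1),
    (if j₀ ≤ j then Polynomial.aeval π (G j) * h ^ (j - j₀) else 0) with hQ
  have hhQ : h ^ j₀ * Q = ∑ j ∈ Finset.range (d + 1), Polynomial.aeval π (G j) * h ^ j := by
    rw [hQ, Finset.mul_sum]
    refine Finset.sum_congr rfl fun j _ => ?_
    split_ifs with hj
    · rw [mul_left_comm, ← pow_add, Nat.add_sub_cancel' hj]
    · rw [hj₀min j (not_le.1 hj), map_zero, zero_mul, mul_zero]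
  have hmem : h ^ j₀ * Q ∈ MvPolynomial.vanishingIdeal k A := by
    rw [mem_vanishingIdeal_pi_iff]
    intro x hx
    rw [hhQ, map_sum, ← hrel x hx]
    refine Finset.sum_congr rfl fun j _ => ?_
    rw [map_mul, map_pow, eval_polynomialAeval_pi]
  rcases hprime.mem_or_mem hmem with hh | hQmem
  · exact hprime.mem_of_pow_mem _ hh
  · -- `Q` vanishes on `Z`, where it restricts to `G_{j₀}(π)`
    exfalso
    apply hj₀spec
    apply Polynomial.eq_zero_of_infinite_isRoot
    refine hZinf.mono ?_
    rintro _ ⟨z, hz, rfl⟩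
    have h0 : MvPolynomial.eval z h = 0 := hZh z hz
    have hQz := mem_vanishingIdeal_pi_iff.1 hQmem z (hZA hz)
    rw [hQ, map_sum, Finset.sum_eq_single j₀] at hQz
    · simpa [eval_polynomialAeval_pi] using hQz
    · intro j _ hne
      split_ifs with hj
      · have hlt : j₀ < j := lt_of_le_of_ne hj (Ne.symm hne)
        rw [map_mul, map_pow, h0, zero_pow (Nat.sub_ne_zero_of_lt hlt), mul_zero]
      · rw [map_zero]
    · intro hj₀r
      exfalso
      exact hj₀r (Finset.mem_range.2 (Nat.lt_succ_of_le (hj₀le.trans hj₁d)))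

end Relation

end Literature.NumberTheory.Automorphic
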